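import Mathlib.Analysis.SpecialFunctions.Pow.Real
import Literature.Barriers.PneNP.NechiporukProofs
import Literature.Computability.Complexity.CircuitClassesProofs
import Literature.Computability.Complexity.FormulaComposition
import Literature.Computability.Complexity.MonotoneFormulaBalancing
import Literature.Computability.MetaComplexity.FormulaModelsAE
import Literature.Computability.MetaComplexity.ChenJinWilliams2019.SparseFormulaMagnification
import Literature.Computability.MetaComplexity.ChenJinWilliams2019.SparseMagnificationConverse
import Literature.Computability.MetaComplexity.ChenJinWilliams2019.SparseFormulaMagnificationConverse
import Literature.Computability.MetaComplexity.ChenJinWilliams2019.SparseFormulaXorMagnificationConverse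
import HarnessLib

/-!
# Chen–Jin–Williams 2019, Theorem 1.1, converse of item 3 (`C = NP`, `B₂`-formulas) — proved

Discharge (D-0014) of the vendored named fact
`Literature.Computability.MetaComplexity.ChenJinWilliams2019.thm11_item3_NP_converse`
(`SparseFormulaMagnification.lean`): `NPNotInFixedPolyFormulas → ∃ ε > 0, SparseNPB2FormulaHardAt ε`,
i.e. if for every `k` some `NP` language is outside `FORMULAae (n ↦ n^k)` (De Morgan formulas of
leaf size `n^k`, almost everywhere), then for every `β ∈ (0,1)` some `2^{n^β}`-sparse `NP` language
is outside `B2FORMULAae (n ↦ ⌈n^{2+ε}⌉)` (formulas over the full binary basis `B₂`, leaf size; here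
with `ε = 1`).

Printed proof (L. Chen, C. Jin, R. R. Williams, *Hardness Magnification for all Sparse NP
Languages*, FOCS 2019; full version ECCC TR19-118, §4.1 p. 14, verbatim): *"The ⇐ direction can be
proved by a simple padding argument. Set `ε = 1`. For every `β ∈ (0, 1)`, by assumption, there is a
language `L_β ∈ NP` without `n^{2/β}` size circuits. Then we can define another language `L'_β ∈ NP`
as `{x10^{|x|^{1/β}−|x|−1} | x ∈ L_β}`. Clearly, `L'_β` does not have `n^{1+ε} = n²` size
circuits, and it is a `2^{n^β}`-sparse language. This padding argument also works for other
computational models (except the last two items in the theorem statement)."* For the model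
`B₂-Formula` of item 3 (hypothesis on `B₂`-formulas, conclusion on De Morgan formulas) the padding
argument uses, implicitly, the classical fact that a `B₂`-formula is a polynomially larger De Morgan
formula (balance it by Spira's lemma, then replace each binary gate by its De Morgan expression;
Jukna 2012, Lemma 6.1 and §6.1).

## The formal proof (same argument, tree vocabulary)

The padded language is the tree's `polyPad q '' L = {⟨x, 1^{|x|^q}⟩ | x ∈ L}` (`q = ⌈1/β⌉`), with `NP`
membership and `2^{n^β}`-sparsity imported from `SparseMagnificationConverse.lean`, the
constant-free restriction of a De Morgan formula along the pad (`Circuit.exists_guardedPad_formula`)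
from the item-4 file and the literal / constant gadgets from the item-2 file. NEW here is
`B₂-Formula ⊆ Formula` with a polynomial blow-up in the tree's straight-line model, by Spira's
argument run DIRECTLY INTO TWO-POLARITY DE MORGAN FORMULAS (no intermediate balanced tree):

* the straight-line `B₂`-formula is unfolded into a fan-in-two tree (`Nechiporuk.FTree.treeOf` of
  `NechiporukProofs.lean`, arbitrary gate functions) with at most `leafSize` variable leaves
  (`FTree.leaves_treeOf_le`, through the occurrence counts `occ_unfold_le_one` of that file);
* `FTree.exists_cut` — Spira's `2/3`-cut with the SEMANTIC split identity `t(x) = t[H ← H(x)](x)`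
  (valid for arbitrary gate functions); `FTree.exists_junta_of_leaves_le_one` — a tree with `≤ 1`
  variable leaf is a junta on one variable;
* `FTree.exists_deMorganFormulas` — by strong induction on the number `m` of leaves, clean De Morgan
  formulas for `t` AND for `¬t` of leaf size `≤ 2·4^{s(m)}`:
  `t^± = (H⁺ ∧ t[H←1]^±) ∨ (H⁻ ∧ t[H←0]^±)`, with `s = AndOrTree.spiraSteps` of
  `MonotoneFormulaBalancing.lean` (`s(m) = s(⌊2m/3⌋) + 1 ≤ 2 log₂ m + 1`, reused), hence
  `≤ 8(m + 1)⁴` (`Circuit.exists_deMorganFormula_of_B2Formula`); a.e. class form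
  `B2FORMULAae s ⊆ FORMULAae (n ↦ 8(s(n)+1)⁴)` (`B2FORMULAae_subset_FORMULAae`).

With `s(N) = ⌈N^{2+1}⌉ = N³` the pad formula becomes a De Morgan formula of `≤ 8(N³+1)⁴ ≤ 128·N¹²`
leaves and its guarded restriction has `≤ n²(128·N¹² + 2) + 2n ≤ n^{12q+3}` leaves for
`n ≥ 31250000004` (`N = 2n + 2 + n^q ≤ 5n^q`, `128·5¹² = 31250000000`), contradicting
`L ∉ FORMULAae (n ↦ n^{12q+3})` (`mem_FORMULAae_of_image_polyPad_mem_B2FORMULAae`).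

Main results: `sparseNPB2FormulaHardAt_one_of_NPNotInFixedPolyFormulas` (quantitative form,
`ε = 1`), `thm11_item3_NP_converse_holds : thm11_item3_NP_converse`, and the hypothesis-reduced
equivalences `sparseNPB2FormulaHard_iff_of_thm11_item3`, `b2FormulaHard_iff_formulaHard_of_thm11`.

## References

* L. Chen, C. Jin, R. R. Williams, *Hardness Magnification for all Sparse NP Languages*, FOCS 2019,
  1240–1255; ECCC TR19-118, Thm. 1.1 and §4.1 (p. 14). [bib: ChenJinWilliams2019]
* S. Jukna, *Boolean Function Complexity* (2012), §1.2 (formulas, leaf size), Lemma 6.1 and §6.1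
  (Spira's theorem; `B₂`-formulas vs. De Morgan formulas). [bib: Jukna2012]
-/

noncomputable section

/-! ### Fan-in-two formula trees: juntas, Spira's cut, leaves of the unfolding -/

namespace Literature.Barriers.PneNP.Nechiporuk.FTree

open Finset Literature.Computability.Complexity Literature.Computability.MetaComplexity

variable {N : ℕ}

/-- A tree without variable leaves computes a constant. [cite: Jukna2012, §1.2 (formulas as trees)] -/
theorem eval_eq_of_leaves_eq_zero : ∀ {t : FTree N}, t.leaves = 0 → ∀ x y, t.eval x = t.eval y
  | var _, h, _, _ => absurd h (by simp)
  | node _ k op c, h, x, y => by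
    rw [leaves_node] at h
    simp only [eval_node]
    congr 1
    funext a
    exact eval_eq_of_leaves_eq_zero ((Finset.sum_eq_zero_iff.1 h) a (mem_univ _)) x y

/-- **A tree with at most one variable leaf is a junta on one variable**: it computes `f(xᵢ)` for
some variable `i` and some `f : Bool → Bool` (over a pointed variable set, so that constants are
covered too). [cite: Jukna2012, Lemma 6.1 (proof idea, p. 160)] -/
theorem exists_junta_of_leaves_le_one (i₀ : Fin N) : ∀ (t : FTree N), t.leaves ≤ 1 →
    ∃ (i : Fin N) (f : Bool → Bool), ∀ x, t.eval x = f (x i)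
  | var i, _ => ⟨i, id, fun _ => rfl⟩
  | node j k op c, h => by
    rw [leaves_node] at h
    by_cases h0 : ∀ a, (c a).leaves = 0
    · refine ⟨i₀, fun _ => (node j k op c).eval fun _ => false, fun x => ?_⟩
      exact eval_eq_of_leaves_eq_zero
        (by rw [leaves_node]; exact Finset.sum_eq_zero fun a _ => h0 a) _ _
    · simp only [not_forall] at h0
      obtain ⟨a₀, ha₀⟩ := h0
      have hsplit := Finset.add_sum_erase univ (fun a => (c a).leaves) (mem_univ a₀)
      have ha₀1 : (c a₀).leaves ≤ 1 := by
        have := Finset.single_le_sum (f := fun a => (c a).leaves) (fun _ _ => Nat.zero_le _)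
          (mem_univ a₀)
        omega
      have hothers : ∀ a, a ≠ a₀ → (c a).leaves = 0 := by
        intro a ha
        have hle : (c a).leaves ≤ ∑ a ∈ univ.erase a₀, (c a).leaves :=
          Finset.single_le_sum (f := fun a => (c a).leaves) (fun _ _ => Nat.zero_le _)
            (Finset.mem_erase.2 ⟨ha, mem_univ a⟩)
        omega
      obtain ⟨i, f, hf⟩ := exists_junta_of_leaves_le_one i₀ (c a₀) ha₀1
      refine ⟨i, fun v => op fun a => if a = a₀ then f v else (c a).eval fun _ => false,
        fun x => ?_⟩
      rw [eval_node]
      congr 1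
      funext a
      by_cases ha : a = a₀
      · subst ha
        rw [if_pos rfl, hf]
      · rw [if_neg ha]
        exact eval_eq_of_leaves_eq_zero (hothers a ha) _ _

/-- **Spira's cut** on fan-in-two trees with arbitrary gate functions: for `1 ≤ k < leaves t`
there are a subtree `H` with `k/2 < leaves H ≤ k` and the contexts `G b = t[H ← b]`
(`leaves (G b) + leaves H = leaves t`) with the SEMANTIC split identity
`t(x) = G_{H(x)}(x)` (no property of the gate functions is used).
[cite: Jukna2012, Lemma 6.1 (proof idea, p. 160)] -/
theorem exists_cut (kk : ℕ) (hk : 1 ≤ kk) : ∀ (t : FTree N), t.FanIn2 → kk < t.leaves →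
    ∃ (H : FTree N) (G : Bool → FTree N), H.FanIn2 ∧ (∀ b, (G b).FanIn2) ∧
      (∀ x, t.eval x = (G (H.eval x)).eval x) ∧ H.leaves ≤ kk ∧ kk < 2 * H.leaves ∧
      ∀ b, (G b).leaves + H.leaves = t.leaves
  | var _, _, h => absurd h (by simp; omega)
  | node j k op c, hF, h => by
    rw [fanIn2_node] at hF
    obtain ⟨hk2, hc⟩ := hF
    rw [leaves_node] at h
    -- a heaviest child
    have hne : (univ : Finset (Fin k)).Nonempty := by
      rw [Finset.univ_nonempty_iff, ← Fin.pos_iff_nonempty]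
      by_contra hk0
      obtain rfl : k = 0 := by omega
      simp at h
    obtain ⟨a₀, -, hmax⟩ := Finset.exists_max_image univ (fun a => (c a).leaves) hne
    have hsum : ∀ g : Fin k → FTree N,
        ∑ a, (g a).leaves = (g a₀).leaves + ∑ a ∈ univ.erase a₀, (g a).leaves :=
      fun g => (Finset.add_sum_erase univ (fun a => (g a).leaves) (mem_univ a₀)).symm
    have hupd : ∀ t' : FTree N, ∑ a ∈ univ.erase a₀, (Function.update c a₀ t' a).leaves =
        ∑ a ∈ univ.erase a₀, (c a).leaves :=
      fun t' => Finset.sum_congr rfl fun a ha => by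
        rw [Function.update_of_ne (Finset.ne_of_mem_erase ha)]
    have hhalf : kk < 2 * (c a₀).leaves := by
      have h1 : ∑ a, (c a).leaves ≤ ∑ _a : Fin k, (c a₀).leaves :=
        Finset.sum_le_sum fun a _ => hmax a (mem_univ a)
      rw [Finset.sum_const, Finset.card_univ, Fintype.card_fin, smul_eq_mul] at h1
      nlinarith
    -- updating one child
    have hfan : ∀ t' : FTree N, t'.FanIn2 → (node j k op (Function.update c a₀ t')).FanIn2 := by
      intro t' ht'
      refine (fanIn2_node _ _ _ _).2 ⟨hk2, fun a => ?_⟩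
      by_cases ha : a = a₀
      · subst ha
        rw [Function.update_self]
        exact ht'
      · rw [Function.update_of_ne ha]
        exact hc a
    have heval : ∀ (t' : FTree N) (x : Fin N → Bool), t'.eval x = (c a₀).eval x →
        (node j k op (Function.update c a₀ t')).eval x = (node j k op c).eval x := by
      intro t' x ht'
      rw [eval_node, eval_node]
      congr 1
      funext a
      by_cases ha : a = a₀
      · subst ha
        rw [Function.update_self, ht']
      · rw [Function.update_of_ne ha]
    have hleaves : ∀ t' : FTree N, (node j k op (Function.update c a₀ t')).leaves + (c a₀).leaves =
        t'.leaves + (node j k op c).leaves := by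
      intro t'
      rw [leaves_node, leaves_node, hsum (Function.update c a₀ t'), hsum c, Function.update_self,
        hupd]
      omega
    have hcst : ∀ b, (node 0 0 (fun _ => b) Fin.elim0 : FTree N).leaves = 0 := fun b => by
      simp [leaves_node]
    by_cases hle : (c a₀).leaves ≤ kk
    · -- stop here: cut out the child `a₀`
      refine ⟨c a₀, fun b => node j k op (Function.update c a₀ (node 0 0 (fun _ => b) Fin.elim0)),
        hc a₀, fun b => hfan _ ((fanIn2_node _ _ _ _).2 ⟨Nat.zero_le _, fun a => a.elim0⟩),
        fun x => (heval (node 0 0 (fun _ => (c a₀).eval x) Fin.elim0) x rfl).symm, hle, hhalf,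
        fun b => ?_⟩
      show (node j k op (Function.update c a₀ (node 0 0 (fun _ => b) Fin.elim0))).leaves +
        (c a₀).leaves = (node j k op c).leaves
      have := hleaves (node 0 0 (fun _ => b) Fin.elim0)
      rw [hcst] at this
      omega
    · -- descend into the child `a₀`
      obtain ⟨H, G, hH, hG, hev, hHle, hH2, hGl⟩ :=
        exists_cut kk hk (c a₀) (hc a₀) (not_le.1 hle)
      refine ⟨H, fun b => node j k op (Function.update c a₀ (G b)), hH, fun b => hfan _ (hG b),
        fun x => (heval (G (H.eval x)) x (hev x).symm).symm, hHle, hH2, fun b => ?_⟩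
      show (node j k op (Function.update c a₀ (G b))).leaves + H.leaves = (node j k op c).leaves
      have := hleaves (G b)
      have := hGl b
      omega

/-! ### Leaves of the unfolding of a straight-line formula -/

/-- `countP` over `ofFn` as a sum of indicators. [folklore] -/
private theorem countP_ofFn_eq_sum {α : Type*} (p : α → Bool) :
    ∀ {k : ℕ} (f : Fin k → α), (List.ofFn f).countP p = ∑ a, if p (f a) then 1 else 0
  | 0, f => by simp
  | k + 1, f => by
    rw [List.ofFn_succ, List.countP_cons, countP_ofFn_eq_sum p (fun i => f i.succ),
      Fin.sum_univ_succ]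
    simp only [add_comm]

/-- Summing a list through `getD`. [folklore] -/
private theorem sum_range_getD : ∀ l : List ℕ, ∑ i ∈ range l.length, l.getD i 0 = l.sum
  | [] => by simp
  | a :: l => by
    rw [List.length_cons, Finset.sum_range_succ', List.sum_cons]
    simp only [List.getD_cons_succ, List.getD_cons_zero]
    rw [sum_range_getD l, add_comm]

/-- **Leaves of the unfolded tree, through occurrences**: every occurrence of gate `i` in the
unfolding contributes the input slots of gate `i`. [cite: Jukna2012, §1.2 (formulas as trees)] -/
theorem leaves_unfold (C : Circuit (Fin N)) : ∀ d m, m < d → m < C.gates.length →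
    (unfold C d m).leaves = ∑ i ∈ range C.gates.length, (unfold C d m).occ i *
      (C.gates.map fun g => (List.ofFn g.args).countP fun w => w.isLeft).getD i 0
  | 0, _, hd, _ => absurd hd (Nat.not_lt_zero _)
  | d + 1, m, hd, hm => by
    rw [unfold_succ_of_lt C d hm]
    simp only [leaves_node, occ_node]
    have hchild : ∀ a : Fin (C.gates[m]).arity,
        (ofWire (unfold C d) ((C.gates[m]).args a)).leaves =
          (if ((C.gates[m]).args a).isLeft then 1 else 0) +
          ∑ i ∈ range C.gates.length, (ofWire (unfold C d) ((C.gates[m]).args a)).occ i *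
            (C.gates.map fun g => (List.ofFn g.args).countP fun w => w.isLeft).getD i 0 := by
      intro a
      cases hw : (C.gates[m]).args a with
      | inl i => simp
      | inr m' =>
        have hm' := C.wf m hm a m' hw
        rw [ofWire_inr, leaves_unfold C d m' (by omega) (by omega)]
        simp
    have hS : (C.gates.map fun g => (List.ofFn g.args).countP fun w => w.isLeft).getD m 0 =
        ∑ a : Fin (C.gates[m]).arity, if ((C.gates[m]).args a).isLeft then 1 else 0 := by
      rw [List.getD_eq_getElem _ _ (by simpa using hm), List.getElem_map, countP_ofFn_eq_sum]
    rw [sum_congr rfl fun a _ => hchild a, sum_add_distrib, sum_comm]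
    simp only [add_mul, sum_add_distrib, sum_mul, boole_mul]
    rw [sum_ite_eq, if_pos (mem_range.2 hm), hS, add_comm]

/-- **The tree of a straight-line formula has at most `leafSize` variable leaves** (every gate
is unfolded at most once, `occ_unfold_le_one`). [cite: Jukna2012, §1.2 (formulas as trees)] -/
theorem leaves_treeOf_le (C : Circuit (Fin N)) (hF : C.IsFormula) :
    (treeOf C).leaves ≤ C.leafSize := by
  have hx : C.leafSize = (C.gates.map fun g => (List.ofFn g.args).countP fun w => w.isLeft).sum +
      (if C.output.isLeft then 1 else 0) := rfl
  unfold treeOf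
  cases hco : C.output with
  | inl i =>
    rw [ofWire_inl, leaves_var, hx, hco]
    simp
  | inr m =>
    have hm := C.wf_output m hco
    rw [ofWire_inr, leaves_unfold C _ m hm hm, hx, hco]
    simp only [Sum.isLeft_inr, Bool.false_eq_true, if_false, add_zero]
    have hlen : (C.gates.map fun g => (List.ofFn g.args).countP fun w => w.isLeft).length =
        C.gates.length := List.length_map _
    calc ∑ i ∈ range C.gates.length, (unfold C C.gates.length m).occ i *
          (C.gates.map fun g => (List.ofFn g.args).countP fun w => w.isLeft).getD i 0
        ≤ ∑ i ∈ range C.gates.length,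
          (C.gates.map fun g => (List.ofFn g.args).countP fun w => w.isLeft).getD i 0 :=
          sum_le_sum fun i _ => by
            calc _ ≤ 1 * _ := Nat.mul_le_mul_right _ (occ_unfold_le_one C hF hm hm i)
              _ = _ := one_mul _
      _ = _ := by rw [← hlen, sum_range_getD]

/-! ### Spira: fan-in-two trees are small De Morgan formulas -/

/-- Clean De Morgan formulas are closed under the binary connectives. [folklore] -/
private theorem clean_binop {op : (Fin 2 → Bool) → Bool}
    (hop : (⟨2, op⟩ : GateFn) ∈ deMorganBasis) {C₁ C₂ : Circuit (Fin N)}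
    (h₁ : C₁.IsOver deMorganBasis ∧ C₁.IsFormula ∧ ∀ m, C₁.output = .inr m → C₁.refCount m = 0)
    (h₂ : C₂.IsOver deMorganBasis ∧ C₂.IsFormula ∧ ∀ m, C₂.output = .inr m → C₂.refCount m = 0) :
    (Circuit.binop op C₁ C₂).IsOver deMorganBasis ∧ (Circuit.binop op C₁ C₂).IsFormula ∧
      ∀ m, (Circuit.binop op C₁ C₂).output = .inr m → (Circuit.binop op C₁ C₂).refCount m = 0 :=
  ⟨Circuit.isOver_binop hop h₁.1 h₂.1, (Circuit.isFormula_binop op h₁.2.1 h₁.2.2 h₂.2.1 h₂.2.2).1,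
    (Circuit.isFormula_binop op h₁.2.1 h₁.2.2 h₂.2.1 h₂.2.2).2⟩

/-- `∧₂` is a De Morgan gate. [folklore] -/
private theorem and_mem : (⟨2, (GateFn.and 2).2⟩ : GateFn) ∈ deMorganBasis := Set.mem_insert _ _

/-- `∨₂` is a De Morgan gate. [folklore] -/
private theorem or_mem : (⟨2, (GateFn.or 2).2⟩ : GateFn) ∈ deMorganBasis :=
  Set.mem_insert_of_mem _ (Set.mem_insert _ _)

/-- **Spira's theorem, De Morgan output (Brent–Spira).** A fan-in-two tree with at most `m`
variable leaves and ARBITRARY gate functions, over `N ≥ 1` variables, is computed — together with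
its complement — by clean De Morgan formulas of leaf size `≤ 2·4^{s(m)}` (`s` = `spiraSteps`, the
number of `2/3`-cuts): cut out `H` with `k/2 < leaves H ≤ k = ⌊2m'/3⌋` (`exists_cut`), so that both
`H` and the contexts `t[H ← b]` have `≤ ⌊2m/3⌋` leaves, and take
`(H⁺ ∧ t[H←1]^±) ∨ (H⁻ ∧ t[H←0]^±)`; a tree with `≤ 1` leaf is a literal or a constant.
[cite: Jukna2012, Lemma 6.1 and §6.1 (pp. 159–160)] -/
theorem exists_deMorganFormulas (i₀ : Fin N) : ∀ (m : ℕ) (t : FTree N), t.FanIn2 → t.leaves ≤ m →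
    ∃ P Q : Circuit (Fin N),
      (P.IsOver deMorganBasis ∧ P.IsFormula ∧ ∀ m', P.output = .inr m' → P.refCount m' = 0) ∧
      (Q.IsOver deMorganBasis ∧ Q.IsFormula ∧ ∀ m', Q.output = .inr m' → Q.refCount m' = 0) ∧
      P.leafSize ≤ 2 * 4 ^ AndOrTree.spiraSteps m ∧ Q.leafSize ≤ 2 * 4 ^ AndOrTree.spiraSteps m ∧
      ∀ x, P.eval x = t.eval x ∧ Q.eval x = !t.eval x := by
  intro m
  induction m using Nat.strong_induction_on with
  | _ m ih =>
  intro t hF htm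
  obtain ⟨Z, Z', hZ, hZ', hZl, hZ'l, hZe⟩ := Circuit.exists_constFormulas i₀
  have h2 : 2 ≤ 2 * 4 ^ AndOrTree.spiraSteps m := by
    have := Nat.one_le_pow (AndOrTree.spiraSteps m) 4 (by norm_num)
    omega
  by_cases ht1 : t.leaves ≤ 1
  · -- a junta on one variable: literal or constant
    obtain ⟨i, f, hf⟩ := exists_junta_of_leaves_le_one i₀ t ht1
    obtain ⟨Pi, Qi, hPi, hQi, hPil, hQil, hie⟩ := Circuit.exists_literalFormulas i
    have pack : ∀ P Q : Circuit (Fin N),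
        (P.IsOver deMorganBasis ∧ P.IsFormula ∧ ∀ m', P.output = .inr m' → P.refCount m' = 0) →
        (Q.IsOver deMorganBasis ∧ Q.IsFormula ∧ ∀ m', Q.output = .inr m' → Q.refCount m' = 0) →
        P.leafSize ≤ 2 → Q.leafSize ≤ 2 → (∀ x, P.eval x = f (x i) ∧ Q.eval x = !f (x i)) →
        ∃ P Q : Circuit (Fin N),
          (P.IsOver deMorganBasis ∧ P.IsFormula ∧ ∀ m', P.output = .inr m' → P.refCount m' = 0) ∧
          (Q.IsOver deMorganBasis ∧ Q.IsFormula ∧ ∀ m', Q.output = .inr m' → Q.refCount m' = 0) ∧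
          P.leafSize ≤ 2 * 4 ^ AndOrTree.spiraSteps m ∧
          Q.leafSize ≤ 2 * 4 ^ AndOrTree.spiraSteps m ∧
          ∀ x, P.eval x = t.eval x ∧ Q.eval x = !t.eval x :=
      fun P Q hP hQ hPl hQl he => ⟨P, Q, hP, hQ, hPl.trans h2, hQl.trans h2, fun x => by
        rw [hf x]; exact he x⟩
    cases hft : f true <;> cases hff : f false
    · exact pack Z Z' hZ hZ' hZl.le hZ'l.le fun x => by
        rw [(hZe x).1, (hZe x).2]; cases x i <;> simp [hft, hff]
    · exact pack Qi Pi hQi hPi (by omega) (by omega) fun x => by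
        rw [(hie x).1, (hie x).2]; cases x i <;> simp [hft, hff]
    · exact pack Pi Qi hPi hQi (by omega) (by omega) fun x => by
        rw [(hie x).1, (hie x).2]; cases x i <;> simp [hft, hff]
    · exact pack Z' Z hZ' hZ hZ'l.le hZl.le fun x => by
        rw [(hZe x).1, (hZe x).2]; cases x i <;> simp [hft, hff]
  · -- Spira's step
    have hm2 : 2 ≤ t.leaves := by omega
    obtain ⟨kk, hkk⟩ : ∃ kk, kk = 2 * t.leaves / 3 := ⟨_, rfl⟩
    have hk1 : 1 ≤ kk := by omega
    have hkm : kk < t.leaves := by omega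
    have hkm3 : kk ≤ 2 * m / 3 := by omega
    have hlt : 2 * m / 3 < m := by omega
    obtain ⟨H, G, hH, hG, hev, hHle, hH2, hGl⟩ := exists_cut kk hk1 t hF hkm
    have hGle : ∀ b, (G b).leaves ≤ kk := fun b => by have := hGl b; omega
    obtain ⟨PH, QH, hPH, hQH, hPHl, hQHl, heH⟩ := ih _ hlt H hH (hHle.trans hkm3)
    obtain ⟨P1, Q1, hP1, hQ1, hP1l, hQ1l, he1⟩ := ih _ hlt (G true) (hG true) ((hGle true).trans hkm3)
    obtain ⟨P0, Q0, hP0, hQ0, hP0l, hQ0l, he0⟩ :=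
      ih _ hlt (G false) (hG false) ((hGle false).trans hkm3)
    have hs : AndOrTree.spiraSteps m = AndOrTree.spiraSteps (2 * m / 3) + 1 :=
      AndOrTree.spiraSteps_of_two_le (by omega)
    refine ⟨Circuit.binop (GateFn.or 2).2 (Circuit.binop (GateFn.and 2).2 PH P1)
        (Circuit.binop (GateFn.and 2).2 QH P0),
      Circuit.binop (GateFn.or 2).2 (Circuit.binop (GateFn.and 2).2 PH Q1)
        (Circuit.binop (GateFn.and 2).2 QH Q0),
      clean_binop or_mem (clean_binop and_mem hPH hP1) (clean_binop and_mem hQH hP0),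
      clean_binop or_mem (clean_binop and_mem hPH hQ1) (clean_binop and_mem hQH hQ0), ?_, ?_,
      fun x => ?_⟩
    · rw [Circuit.leafSize_binop, Circuit.leafSize_binop, Circuit.leafSize_binop, hs, pow_succ]
      omega
    · rw [Circuit.leafSize_binop, Circuit.leafSize_binop, Circuit.leafSize_binop, hs, pow_succ]
      omega
    · rw [hev x]
      simp only [Circuit.eval_binop, Circuit.and_two_apply_pair, Circuit.or_two_apply_pair,
        (heH x).1, (heH x).2, (he1 x).1, (he1 x).2, (he0 x).1, (he0 x).2]
      cases H.eval x <;> simp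

end Literature.Barriers.PneNP.Nechiporuk.FTree

/-! ### `B₂`-formulas are De Morgan formulas with a polynomial blow-up -/

namespace Literature.Computability.Complexity.Circuit

open Finset Literature.Computability.MetaComplexity Literature.Barriers.PneNP.Nechiporuk

variable {N : ℕ}

/-- `2·4^{s(m)} ≤ 8(m+1)⁴` (`s(m) ≤ 2 log₂ m + 1`). [folklore] -/
private theorem two_mul_four_pow_spiraSteps_le (m : ℕ) :
    2 * 4 ^ AndOrTree.spiraSteps m ≤ 8 * (m + 1) ^ 4 := by
  have hs := AndOrTree.spiraSteps_le m
  rcases Nat.eq_zero_or_pos m with rfl | hm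
  · rw [AndOrTree.spiraSteps_of_le_one (by norm_num)]
    norm_num
  · have hlog : 2 ^ Nat.log 2 m ≤ m := Nat.pow_log_le_self 2 (by omega)
    calc 2 * 4 ^ AndOrTree.spiraSteps m ≤ 2 * 4 ^ (2 * Nat.log 2 m + 1) :=
          Nat.mul_le_mul_left 2 (Nat.pow_le_pow_right (by norm_num) hs)
      _ = 8 * (2 ^ Nat.log 2 m) ^ 4 := by
          rw [pow_succ, pow_mul, show (4 : ℕ) ^ 2 = 16 from rfl,
            show (16 : ℕ) = 2 ^ 4 from rfl, ← pow_mul, ← pow_mul, mul_comm 4 (Nat.log 2 m),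
            pow_mul]
          ring
      _ ≤ 8 * m ^ 4 := Nat.mul_le_mul_left 8 (Nat.pow_le_pow_left hlog 4)
      _ ≤ 8 * (m + 1) ^ 4 := Nat.mul_le_mul_left 8 (Nat.pow_le_pow_left (Nat.le_succ m) 4)

/-- **`B₂-Formula ⊆ Formula` with a polynomial blow-up (Brent–Spira for straight-line formulas).**
A straight-line formula over the full binary basis `B₂` (fan-in `≤ 2`, all gate functions,
fan-out `≤ 1`) of leaf size `ℓ` on `N ≥ 1` variables is computed by a De Morgan formula of leaf
size `≤ 8(ℓ + 1)⁴`: unfold it into a fan-in-two tree with `≤ ℓ` variable leaves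
(`FTree.treeOf`, `FTree.leaves_treeOf_le`) and apply `FTree.exists_deMorganFormulas`.
[cite: Jukna2012, Lemma 6.1 and §6.1 (Spira; De Morgan formulas from balanced `B₂` trees)] -/
theorem exists_deMorganFormula_of_B2Formula (i₀ : Fin N) (C : Circuit (Fin N)) (hB : C.IsOver B2)
    (hF : C.IsFormula) :
    ∃ D : Circuit (Fin N), D.IsOver deMorganBasis ∧ D.IsFormula ∧
      D.leafSize ≤ 8 * (C.leafSize + 1) ^ 4 ∧ ∀ x, D.eval x = C.eval x := by
  obtain ⟨P, Q, hP, -, hPl, -, he⟩ := FTree.exists_deMorganFormulas i₀ C.leafSize (FTree.treeOf C)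
    (FTree.fanIn2_treeOf C hB) (FTree.leaves_treeOf_le C hF)
  exact ⟨P, hP.1, hP.2.1, hPl.trans (two_mul_four_pow_spiraSteps_le _), fun x => by
    rw [(he x).1, FTree.eval_treeOf]⟩

end Literature.Computability.Complexity.Circuit

namespace Literature.Computability.MetaComplexity

open Literature.Computability.Complexity

/-- **`B2FORMULAae s ⊆ FORMULAae (n ↦ 8(s(n)+1)⁴)`**: the a.e. class form of Brent–Spira — at every
length `n ≥ 1` past the threshold convert the `B₂`-formula by
`Circuit.exists_deMorganFormula_of_B2Formula`; below the threshold any circuit for the slice will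
do. [cite: Jukna2012, Lemma 6.1 and §6.1] -/
theorem B2FORMULAae_subset_FORMULAae (s : ℕ → ℕ) :
    B2FORMULAae s ⊆ FORMULAae fun n => 8 * (s n + 1) ^ 4 := by
  rintro L ⟨C, ⟨n₀, hn₀⟩, hdec⟩
  have family : ∀ n : ℕ, ∃ D : Circuit (Fin n),
      (max n₀ 1 ≤ n → D.IsOver deMorganBasis ∧ D.IsFormula ∧ D.leafSize ≤ 8 * (s n + 1) ^ 4) ∧
      ∀ u : Fin n → Bool, D.eval u = (L : Set (List Bool)).boolIndicator (List.ofFn u) := by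
    intro n
    by_cases hn : max n₀ 1 ≤ n
    · obtain ⟨hB, hF, hl⟩ := hn₀ n (le_of_max_le_left hn)
      obtain ⟨D, hDB, hDF, hDl, hDe⟩ :=
        (C n).exists_deMorganFormula_of_B2Formula ⟨0, le_of_max_le_right hn⟩ hB hF
      exact ⟨D, fun _ => ⟨hDB, hDF, hDl.trans (Nat.mul_le_mul_left 8
        (Nat.pow_le_pow_left (Nat.succ_le_succ hl) 4))⟩, fun u => by rw [hDe, hdec.eval_eq]⟩
    · obtain ⟨D, -, hD⟩ :=
        exists_circuit_eval_eq n fun u => (L : Set (List Bool)).boolIndicator (List.ofFn u)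
      exact ⟨D, fun h => absurd h hn, hD⟩
  choose D hD using family
  refine ⟨D, ⟨max n₀ 1, fun n hn => (hD n).1 hn⟩, fun x => ?_⟩
  have := (hD x.length).2 x.get
  rwa [List.ofFn_get] at this

end Literature.Computability.MetaComplexity

namespace Literature.Computability.MetaComplexity

open Literature.Computability.Complexity

namespace ChenJinWilliams2019

open Literature.Computability.Complexity.Nondeterministic Literature.Computability.Complexity.Brick

/-! ### The padded language `polyPad q '' L` (as in the sibling converse files) -/

/-- A pad lies in the padded language iff its payload lies in `L` (`polyPad q` is injective: its
first component is the payload). [folklore] -/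
private theorem polyPad_mem_image_iff {q : ℕ} {L : Language Bool} {x : List Bool} :
    polyPad q x ∈ polyPad q '' L ↔ x ∈ L :=
  (show Function.Injective (polyPad q) from fun x y h => by simpa using congrArg fstF h).mem_set_image

/-- The indicator of the padded language at a pad is the indicator of `L` at the payload.
[folklore] -/
private theorem boolIndicator_image_polyPad (q : ℕ) (L : Language Bool) (x : List Bool) :
    (polyPad q '' L).boolIndicator (polyPad q x) = (L : Set (List Bool)).boolIndicator x := by
  by_cases hx : x ∈ L
  · rw [((polyPad q '' L).mem_iff_boolIndicator _).1 (polyPad_mem_image_iff.2 hx),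
      ((L : Set (List Bool)).mem_iff_boolIndicator _).1 hx]
  · rw [((polyPad q '' L).notMem_iff_boolIndicator _).1
        (fun h => hx (polyPad_mem_image_iff.1 h)),
      ((L : Set (List Bool)).notMem_iff_boolIndicator _).1 hx]

/-! ### Hardness transfer (print: "This padding argument also works for other computational models") -/

/-- `⌈N^{2+1}⌉ = N³`. [folklore] -/
private theorem powCeil_two_add_one (N : ℕ) : powCeil (2 + 1) N = N ^ 3 := by
  unfold powCeil
  rw [show (2 : ℝ) + 1 = ((3 : ℕ) : ℝ) by norm_num, Real.rpow_natCast, ← Nat.cast_pow,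
    Nat.ceil_natCast]

/-- `8(N³ + 1)⁴ ≤ 128·N¹²` for `N ≥ 1`. [folklore] -/
private theorem eight_mul_pow_le {N : ℕ} (hN : 1 ≤ N) : 8 * (N ^ 3 + 1) ^ 4 ≤ 128 * N ^ 12 := by
  have h1 : 1 ≤ N ^ 3 := Nat.one_le_pow _ _ hN
  calc 8 * (N ^ 3 + 1) ^ 4 ≤ 8 * (2 * N ^ 3) ^ 4 :=
        Nat.mul_le_mul_left 8 (Nat.pow_le_pow_left (by omega) 4)
    _ = 128 * N ^ 12 := by ring

/-- Size bookkeeping of the transfer: for `1 ≤ q`, `N = 2n + 2 + n^q` and `n ≥ 31250000004`,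
`n²·(128·N¹² + 2) + 2n ≤ 31250000004·n^{12q+2} ≤ n^{12q+3}`. [folklore] -/
private theorem padLeaf_le₃ {q : ℕ} (hq : 1 ≤ q) {n : ℕ} (hn : 31250000004 ≤ n) :
    n * n * (128 * (2 * n + 2 + n ^ q) ^ 12 + 2) + 2 * n ≤ n ^ (12 * q + 3) := by
  have hnq : n ≤ n ^ q := Nat.le_self_pow (by omega) n
  have h5 : 2 * n + 2 + n ^ q ≤ 5 * n ^ q := by omega
  have h4 : (2 * n + 2 + n ^ q) ^ 12 ≤ 244140625 * n ^ (12 * q) :=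
    calc (2 * n + 2 + n ^ q) ^ 12 ≤ (5 * n ^ q) ^ 12 := Nat.pow_le_pow_left h5 12
      _ = 244140625 * n ^ (12 * q) := by ring
  have h1 : 0 < n ^ (12 * q) := Nat.pos_of_ne_zero (pow_ne_zero _ (by omega))
  have h2 : n ≤ n * n * n ^ (12 * q) := by
    rw [mul_assoc]
    exact Nat.le_mul_of_pos_right n (Nat.mul_pos (by omega) h1)
  have h3 : 128 * (2 * n + 2 + n ^ q) ^ 12 + 2 ≤ 31250000002 * n ^ (12 * q) := by omega
  calc n * n * (128 * (2 * n + 2 + n ^ q) ^ 12 + 2) + 2 * n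
      ≤ n * n * (31250000002 * n ^ (12 * q)) + 2 * (n * n * n ^ (12 * q)) :=
        Nat.add_le_add (Nat.mul_le_mul_left _ h3) (Nat.mul_le_mul_left _ h2)
    _ = 31250000004 * (n * n * n ^ (12 * q)) := by ring
    _ ≤ n * (n * n * n ^ (12 * q)) := Nat.mul_le_mul_right _ hn
    _ = n ^ (12 * q + 3) := by ring

/-- Every bit vector is non-constant, all ones, or all zeros. [folklore] -/
private theorem exists_pair_or_eq_const {n : ℕ} (u : Fin n → Bool) :
    (∃ i i', u i = true ∧ u i' = false) ∨ u = (fun _ => true) ∨ u = (fun _ => false) := by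
  by_cases h0 : ∃ i', u i' = false
  · by_cases h1 : ∃ i, u i = true
    · obtain ⟨i, hi⟩ := h1
      obtain ⟨i', hi'⟩ := h0
      exact Or.inl ⟨i, i', hi, hi'⟩
    · refine Or.inr (Or.inr (funext fun i => ?_))
      simpa using not_exists.1 h1 i
  · refine Or.inr (Or.inl (funext fun i => ?_))
    simpa using not_exists.1 h0 i

/-- **Hardness transfer by padding, `B₂`-formulas to De Morgan formulas.** If the padded language
`polyPad q '' L` (`1 ≤ q`) has `B₂`-formulas of leaf size `≤ ⌈N^{2+1}⌉ = N³` at every large length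
`N`, then `L` has De Morgan formulas of leaf size `≤ n^{12q+3}` at every large length `n`: at length
`n ≥ 31250000004` convert the `B₂`-formula for the pad length `N = 2n + 2 + n^q` into a De Morgan
formula of leaf size `≤ 8(N³ + 1)⁴ ≤ 128·N¹²` (`Circuit.exists_deMorganFormula_of_B2Formula`) and
take its guarded pad formula (`Circuit.exists_guardedPad_formula`): leaf size
`≤ n²(128·N¹² + 2) + 2n ≤ n^{12q+3}` (`padLeaf_le₃`). Small lengths: any circuit for the slice.
[cite: ChenJinWilliams2019, Thm. 1.1 (converse of item 3), TR19-118 §4.1 p. 14] -/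
theorem mem_FORMULAae_of_image_polyPad_mem_B2FORMULAae {q : ℕ} (hq : 1 ≤ q) {L : Language Bool}
    (h : polyPad q '' L ∈ B2FORMULAae (powCeil (2 + 1))) :
    L ∈ FORMULAae fun n => n ^ (12 * q + 3) := by
  obtain ⟨C, ⟨N₀, hN₀⟩, hdec⟩ := h
  -- the pad of `u` is read by the formula for the padded language as `[ofFn u ∈ L]`
  have hpad : ∀ (n : ℕ) (u : Fin n → Bool), (C (2 * n + 2 + n ^ q)).eval
      (pairVec u fun _ : Fin (n ^ q) => true) = (L : Set (List Bool)).boolIndicator (List.ofFn u) := by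
    intro n u
    rw [hdec.eval_eq, ofFn_pairVec, List.ofFn_const]
    have hpad : boolPair (List.ofFn u) (List.replicate (n ^ q) true) = polyPad q (List.ofFn u) := by
      rw [polyPad, List.length_ofFn]
    rw [hpad, boolIndicator_image_polyPad]
  -- at every length `n = k + 2` whose pad is long enough: convert, then restrict along the pad
  have main : ∀ k : ℕ, N₀ ≤ 2 * (k + 2) + 2 + (k + 2) ^ q →
      ∃ H : Circuit (Fin (k + 2)), H.IsOver deMorganBasis ∧ H.IsFormula ∧
        H.leafSize ≤ (k + 2) * (k + 2) * (128 * (2 * (k + 2) + 2 + (k + 2) ^ q) ^ 12 + 2) +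
          2 * (k + 2) ∧
        ∀ u : Fin (k + 2) → Bool, H.eval u = (L : Set (List Bool)).boolIndicator (List.ofFn u) := by
    intro k hk
    obtain ⟨hB, hF, hl⟩ := hN₀ _ hk
    rw [powCeil_two_add_one] at hl
    obtain ⟨D, hDB, hDF, hDl, hDe⟩ := (C (2 * (k + 2) + 2 + (k + 2) ^ q))
      |>.exists_deMorganFormula_of_B2Formula ⟨0, by omega⟩ hB hF
    have hDl' : D.leafSize ≤ 128 * (2 * (k + 2) + 2 + (k + 2) ^ q) ^ 12 :=
      hDl.trans ((Nat.mul_le_mul_left 8 (Nat.pow_le_pow_left (Nat.succ_le_succ hl) 4)).trans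
        (eight_mul_pow_le (by omega)))
    obtain ⟨H, hHB, hHF, hHl, hmix, h₁, h₀⟩ := D.exists_guardedPad_formula hDB hDF
        ((L : Set (List Bool)).boolIndicator (List.ofFn fun _ : Fin (k + 2) => true))
        ((L : Set (List Bool)).boolIndicator (List.ofFn fun _ : Fin (k + 2) => false))
    refine ⟨H, hHB, hHF, hHl.trans (Nat.add_le_add_right (Nat.mul_le_mul_left _
      (Nat.add_le_add_right hDl' 2)) _), fun u => ?_⟩
    rcases exists_pair_or_eq_const u with hu | rfl | rfl
    · rw [hmix u hu, hDe, hpad]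
    · exact h₁
    · exact h₀
  -- the family: from `max N₀ 31250000004` on the formulas above, anything before
  have family : ∀ n : ℕ, ∃ D : Circuit (Fin n),
      (max N₀ 31250000004 ≤ n →
        D.IsOver deMorganBasis ∧ D.IsFormula ∧ D.leafSize ≤ n ^ (12 * q + 3)) ∧
      ∀ u : Fin n → Bool, D.eval u = (L : Set (List Bool)).boolIndicator (List.ofFn u) := by
    intro n
    by_cases hn : max N₀ 31250000004 ≤ n
    · have hbig : 31250000004 ≤ n := le_of_max_le_right hn
      have hN₀n : N₀ ≤ n := le_of_max_le_left hn
      obtain ⟨k, rfl⟩ : ∃ k, n = k + 2 := ⟨n - 2, by omega⟩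
      have hN : N₀ ≤ 2 * (k + 2) + 2 + (k + 2) ^ q := hN₀n.trans (by omega)
      obtain ⟨H, hHB, hHF, hHl, hHe⟩ := main k hN
      exact ⟨H, fun _ => ⟨hHB, hHF, hHl.trans (padLeaf_le₃ hq hbig)⟩, hHe⟩
    · obtain ⟨D, -, hD⟩ :=
        exists_circuit_eval_eq n fun u => (L : Set (List Bool)).boolIndicator (List.ofFn u)
      exact ⟨D, fun h => absurd h hn, hD⟩
  choose D hD using family
  refine ⟨D, ⟨max N₀ 31250000004, fun n hn => (hD n).1 hn⟩, fun x => ?_⟩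
  have := (hD x.length).2 x.get
  rwa [List.ofFn_get] at this

/-! ### The named fact -/

/-- **Chen–Jin–Williams 2019, Thm. 1.1, converse of item 3 (`C = NP`), quantitative form with
`ε = 1`:** if for every `k` some `NP` language is outside `FORMULAae (n ↦ n^k)`, then for every
`β ∈ (0,1)` some `2^{n^β}`-sparse `NP` language is outside `B2FORMULAae (n ↦ ⌈n^{2+1}⌉)` — namely
the pad `{⟨x, 1^{|x|^q}⟩ | x ∈ L}`, `q = ⌈1/β⌉`, of an `NP` language `L ∉ FORMULAae (n ↦ n^{12q+3})`.
Printed: TR19-118 §4.1 p. 14, "The ⇐ direction can be proved by a simple padding argument. Set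
`ε = 1`. … This padding argument also works for other computational models".
[cite: ChenJinWilliams2019, Thm. 1.1 (converse of item 3), TR19-118 §4.1 p. 14] -/
theorem sparseNPB2FormulaHardAt_one_of_NPNotInFixedPolyFormulas
    (h : ChenJinWilliams2020.NPNotInFixedPolyFormulas) : SparseNPB2FormulaHardAt 1 := by
  intro β hβ0 _hβ1
  have hq : 1 ≤ ⌈1 / β⌉₊ := Nat.ceil_pos.2 (by positivity)
  have hqβ : 1 ≤ (⌈1 / β⌉₊ : ℝ) * β := by
    have h1 : 1 / β ≤ (⌈1 / β⌉₊ : ℝ) := Nat.le_ceil (1 / β)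
    calc (1 : ℝ) = 1 / β * β := by field_simp
      _ ≤ (⌈1 / β⌉₊ : ℝ) * β := mul_le_mul_of_nonneg_right h1 hβ0.le
  obtain ⟨L, hL, hhard⟩ := h (12 * ⌈1 / β⌉₊ + 3)
  exact ⟨polyPad ⌈1 / β⌉₊ '' L, image_polyPad_mem_NP _ hL, isSparse_image_polyPad hβ0 hqβ L,
    fun hc => hhard (mem_FORMULAae_of_image_polyPad_mem_B2FORMULAae hq hc)⟩

/-- **Discharge of the named fact `thm11_item3_NP_converse`** (Chen–Jin–Williams 2019, Thm. 1.1,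
"Moreover, the converse of each item above also holds", item 3, `C = NP`):
`NPNotInFixedPolyFormulas → ∃ ε > 0, SparseNPB2FormulaHardAt ε`, with `ε = 1`.
[cite: ChenJinWilliams2019, Thm. 1.1 (converse of item 3), TR19-118 pp. 4, 14] -/
theorem thm11_item3_NP_converse_holds : thm11_item3_NP_converse :=
  fun h => ⟨1, one_pos, sparseNPB2FormulaHardAt_one_of_NPNotInFixedPolyFormulas h⟩

/-- Every `ε ∈ [0,1]` works in the converse (antitonicity of `SparseNPB2FormulaHardAt` in `ε`).
[cite: ChenJinWilliams2019, Thm. 1.1 (converse of item 3), TR19-118 §4.1 p. 14] -/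
theorem sparseNPB2FormulaHardAt_of_NPNotInFixedPolyFormulas
    (h : ChenJinWilliams2020.NPNotInFixedPolyFormulas) {ε : ℝ} (hε0 : 0 ≤ ε) (hε1 : ε ≤ 1) :
    SparseNPB2FormulaHardAt ε :=
  (sparseNPB2FormulaHardAt_one_of_NPNotInFixedPolyFormulas h).anti hε0 hε1

/-- The printed EQUIVALENCE of Thm. 1.1 item 3 (`C = NP`) with only the magnification direction
left as a named-fact hypothesis: the sparse-language `B₂`-formula hypothesis (at some `ε > 0`) holds
iff `NP ⊄ Formula[n^k] ∀ k` (`sparseNPB2FormulaHard_iff` fed with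
`thm11_item3_NP_converse_holds`).
[cite: ChenJinWilliams2019, Thm. 1.1 (item 3 and its converse), TR19-118 pp. 3–4, 14] -/
theorem sparseNPB2FormulaHard_iff_of_thm11_item3 (h : thm11_item3_NP) :
    (∃ ε : ℝ, 0 < ε ∧ SparseNPB2FormulaHardAt ε) ↔ ChenJinWilliams2020.NPNotInFixedPolyFormulas :=
  sparseNPB2FormulaHard_iff h thm11_item3_NP_converse_holds

/-- With both converses proved (`thm11_item3_NP_converse_holds`, `thm11_item4_NP_converse_holds`),
the mutual equivalence of the item-3 and item-4 hypotheses needs only the two magnification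
directions. [cite: ChenJinWilliams2019, Thm. 1.1 (items 3, 4 and their converses), TR19-118 pp. 3–4, 14] -/
theorem b2FormulaHard_iff_formulaHard_of_thm11 (h₃ : thm11_item3_NP) (h₄ : thm11_item4_NP) :
    (∃ ε : ℝ, 0 < ε ∧ SparseNPB2FormulaHardAt ε) ↔ (∃ ε : ℝ, 0 < ε ∧ SparseNPFormulaHardAt ε) :=
  b2FormulaHard_iff_formulaHard h₃ thm11_item3_NP_converse_holds h₄ thm11_item4_NP_converse_holds

end ChenJinWilliams2019

end Literature.Computability.MetaComplexity
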